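import Literature.NumberTheory.FaltingsSerre.GaloisCertificate
import Literature.NumberTheory.FaltingsSerre.Paramodular587plus
import HarnessLib

/-!
# The Faltings–Serre method after Brumer–Pacetti–Poor–Tornaría–Voight–Yuen:
# the instance `N = 587`, Fricke sign `+`, in CORE form — and by TRANSFER of the Galois half of `A₅₈₇`

[BPPTVY] = A. Brumer, A. Pacetti, C. Poor, G. Tornaría, J. Voight, D. S. Yuen, *On the paramodularity of
typical abelian surfaces*, Algebra & Number Theory **13**:5 (2019) 1145–1195 [cite: BrumerEtAl2019]
(PRINTED numbering and pages): §7.3 p. 1191, Theorem 7.3.1 (the Jacobian `A₅₈₇` of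
`y² + (x³+x+1)y = −x²−x`, LMFDB `587.a.587.1`, is paramodular of level `587` with partner `f₅₈₇⁻`;
residual image `S₆`, `2`-division sextic `x⁶ − 2x⁵ + 2x⁴ − x² + 2x − 1`, printed check set
`P(587) = {3,5,7,11,13,17,19,23,29,37,41}`); Algorithm 2.4.1 p. 1156; Theorem 4.3.4 p. 1169;
(5.1.8) p. 1174 (an element of order `3` with a trace condition kills the outer automorphism of `S₆`).
[PY15] = C. Poor, D. S. Yuen, *Paramodular cusp forms*, Math. Comp. **84** (2015) 1401–1438
[cite: PoorYuen2015]: Thm 1.1 / Table 5 p. 1433 — one weight-2 nonlift in EACH Fricke eigenspace at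
level `587`.

WHAT THIS FILE IS.  `Paramodular587plus.lean` states the paramodularity of the plus pair
`(A⁺ = Jac(C⁺), f₅₈₇⁺)`, `C⁺ : y² + (x³+x+1)y = −x⁶+4x⁴+x³+2x²−14x+14` (LMFDB class `587.a`), a pair not
treated in print ([Thm 7.3.1] is the minus pair), from ONE hypothesis `Certificate587plus` attested by
the cell's merged certificate `certs/587/plus/certificate.canonical.json` (sha256
`9ac7f5381b505f82e7e8e9323eccada07156e3105b7cfaeb79e03dd40afb02f1`, REFEREE.md ruling S46, freeze audit
= Audit 77).  This file gives the same conclusion in the two sharper shapes of `CoreCertificate.lean`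
(D-25) and `GaloisCertificate.lean` (D-27):

(1) CORE form, `paramodular_587plus_of_coreCertificate`: the certificate hypothesis
`CoreCertificate587plus` attests only the five core blocks (two similitudes, Step 1 up to frame,
absolute irreducibility, Steps 2–4), the Step-5 trace table being the visible integer hypothesis
`h5 : ∀ p ∈ checkPrimes587plus, aA p = af p` (`a_p(A⁺) = λ_p(f₅₈₇⁺) = 0,0,−2,1,0,−2,5,9,−3,0,5`).

(2) TRANSFER form, `paramodular_587plus_of_galoisCertificate` — the shape in which the cell ACTUALLY
certified the plus pair: Steps 2–4 were never run for `A⁺`; they are the engineer-1 Galois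
sub-certificate of BPPTVY's `A₅₈₇` (`certs/587/galois/galois_certificate.canonical.json`, sha256
`5ba9346a657202460934ea21b5dd12813c66f8395b03112b83a27684d831ddaf`, referee Audit 45: `K₀` = the
printed degree-20 field, `Cl_S(K₀) = 1` GRH-free ×2, the seven extension groups of [Thm 5.3.3(b)] ×2,
witness search complete ×2 with check primes = the printed `P(587)` = `checkPrimes587plus`), and the
plus certificate imports them through `ℚ(A⁺[2]) = ℚ(A₅₈₇[2])` (sub-certificate `certs/587/galois_plus`,
sha256 `6872150ba85cff30fc63b069ff597ae964ff5b5b214e11a3b81869d39af57a0c`).  In (2) that transfer is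
performed IN THE KERNEL: from the Galois half `GaloisCertificate587 ν₀ ρ₀` of `A₅₈₇`, `#im ρ̄_{A₅₈₇} = 720`
(Galois group `S₆`, ×2), equality of the two `2`-division fields (`hker`), and the Euler factors at the
single prime `3` — `L₃(A₅₈₇) = 1 + 4T + 9T² + 12T³ + 9T⁴`, `L₃(A⁺) = 1 + T² + 9T⁴`: `a₃` even, `b₃` odd on
both sides, so a Frobenius at `3` has order `3` or `6` under `ρ̄` with equal traces [(5.1.8)] — the
theorem `paramodular_of_galoisCertificate_S6` PRODUCES `π ∈ S₆` with `ρ̄_{A⁺} = ι(π) ρ̄_{A₅₈₇} ι(π)⁻¹`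
(`exists_residual_conj_of_eulerData`) and transports Steps 2–4 and absolute irreducibility along it
(`GaloisCertificate.ofResidualConj`); what remains attested for the plus pair is its PAIR datum
`PairCertificate587plus` (two similitudes [(4.1.3); Thm 4.3.4 (ii)] and Step 1 up to frame for
`(ρ_{A⁺}, ρ_{f⁺})`: blocks `residual.rhobar_f_equals_rhobar_A` route 1 ×2 and Route E of the plus
certificate) and its trace table `h5`.

Certificates are `Prop`-valued BINDERS carrying a sha256 in their docstring, never Literature facts; no
datum of the cell enters the kernel as an axiom.  No new mathematics is proved here (one-line
specialisations; the criterion [Thm 2.1.5] is the tree theorem `traceEq_of_faltingsSerre_symplectic_holds`,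
consumed inside the templates).  Companions: `Paramodular587plus.lean` (`paramodular_587plus`),
`Paramodular587plusHolds.lean` (`paramodular_587plus_holds`), `KernelResidualExclusion587.lean`,
`KernelCounts587plus.lean` / `KernelCounts587minus.lean` (kernel-decided point counts).

## References
* [BPPTVY] Thm 7.3.1 p. 1191; Alg 2.4.1 p. 1156; Thm 2.1.5 p. 1150; (4.1.3)–(4.1.5) pp. 1163–1164;
  Thm 4.3.4 p. 1169; Lemma 5.1.7 p. 1173; (5.1.8) p. 1174; Thm 5.3.3 p. 1176; §7.1 p. 1188.
  [cite: BrumerEtAl2019]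
* [PY15] Thm 1.1 p. 1402, Table 5 p. 1433 (`f₅₈₇⁺`, `f₅₈₇⁻`). [cite: PoorYuen2015]
-/

noncomputable section

namespace Literature.NumberTheory.FaltingsSerre.Paramodular587plus

open Polynomial IsDedekindDomain Field Literature.NumberTheory.FaltingsSerre
  Literature.NumberTheory.GaloisRepresentations Literature.NumberTheory.FaltingsSerre.GSp4F2
  Literature.NumberTheory.Automorphic.Paramodular Literature.NumberTheory.Automorphic
  Literature.AlgebraicGeometry.Motives
open scoped NumberField

/-- The eleven check primes `checkPrimes587plus = P(587) = {3,5,7,11,13,17,19,23,29,37,41}`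
(`Paramodular587plus.lean`; BPPTVY's printed set) are good odd primes: prime, `∤ 587`, `≠ 2` — the
hypothesis `hT` of the core templates. [cite: BrumerEtAl2019, Thm 7.3.1 p. 1191; Alg 2.4.1 Step 4 p. 1156] -/
theorem checkPrimes587plus_good : ∀ p ∈ checkPrimes587plus, p.Prime ∧ ¬ p ∣ 587 ∧ p ≠ 2 := by
  decide

/-- **The Galois half at level `587`, as a hypothesis**: `GaloisCertificate 587 checkPrimes587plus ν ρ`
(`GaloisCertificate.lean`: `similitude` [(4.1.3)], `absIrreducible`, `complete` = Steps 2–4 with `S` =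
places over `{2, 587}` and check primes `P(587)`).  For `ρ = ρ_{A₅₈₇,2}` framed (BPPTVY's curve
`y² + (x³+x+1)y = −x²−x`, the minus pair) it is attested OUTSIDE THE KERNEL by the engineer-1
sub-certificate `certs/587/galois/galois_certificate.canonical.json`, sha256
`5ba9346a657202460934ea21b5dd12813c66f8395b03112b83a27684d831ddaf` (referee Audit 45; GRH-free; every
load-bearing item ×2): blocks `two_division`/`residual` (image `S₆ = Sp₄(𝔽₂)`: `ℚ(A₅₈₇[2])` = splitting
field of the printed sextic, Galois group `S₆` by PARI `polgalois` and by a Jordan argument; absolutely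
irreducible — also a THEOREM for image `S₆`, `GaloisCertificate.of_card_eq`), `classfield`
(`K₀` = the printed degree-20 field, `Cl_S(K₀) = 1` twice, `dim K₀(S,2) = 19`), `group_theory` (the
seven extension groups of [Thm 5.3.3(b)], `k = 0,0,1,5,5,6,10`, Python and GAP), `obstructing`
(witness search over the `2¹⁹ − 1` quadratic extensions, four runs with crossed tables/fields, complete;
`P_used` = printed `P(587)` = `checkPrimes587plus`).  A `Prop` used as a binder, never a Literature
fact. [cite: BrumerEtAl2019, §7.3 p. 1191; Alg 2.4.1 Steps 2–4 p. 1156; Thm 5.3.3 p. 1176; Lemma 5.1.7 p. 1173] -/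
def GaloisCertificate587 (ν : absoluteGaloisGroup ℚ → ℤ_[2]) (ρ : FramedGaloisRep ℚ ℤ_[2] 4) : Prop :=
  GaloisCertificate 587 checkPrimes587plus ν ρ

/-- **The pair datum of the plus pair, as a hypothesis**: `PairCertificate ν ρA ρf`
(`GaloisCertificate.lean`: the two similitude identities with common multiplier [(4.1.3); Thm 4.3.4
(ii)] and Step 1 up to frame, `∃ π ∈ S₆, ρ̄_f = ι(π) ρ̄_A ι(π)⁻¹`).  For `(ρA, ρf)` = framed
`(ρ_{A⁺,2}, ρ_{f₅₈₇⁺,2})` it is attested OUTSIDE THE KERNEL by the merged plus certificate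
`certs/587/plus/certificate.canonical.json`, sha256
`9ac7f5381b505f82e7e8e9323eccada07156e3105b7cfaeb79e03dd40afb02f1` (REFEREE.md ruling S46, Audit 77):
block `residual` — image of `ρ̄_{A⁺}` is `S₆` (×2), `ρ̄_{f⁺} ≃ ρ̄_{A⁺}` by route 1 (the residual sieve
for `(ρ̄, S)`: `Q₃(f₅₈₇⁺) ≡ 1+T²+T⁴`, `Q₁₁(f₅₈₇⁺) ≡ 1+T+T²+T³+T⁴ (mod 2)`, each coefficient by two
recomputations; candidate fields from the LMFDB, completeness CITED as BPPTVY cite Jones–Roberts) and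
independently by route 2 (Route E, étale-algebra sieve on `λ_p` parities); the similitude identities are
the cited [(4.1.3)] and [Thm 4.3.4 (ii)].  A `Prop` used as a binder, never a Literature fact.
[cite: BrumerEtAl2019, Alg 2.4.1 Step 1 p. 1156; §2.3 p. 1149; (4.1.3) p. 1163; Thm 4.3.4 p. 1169] -/
def PairCertificate587plus (ν : absoluteGaloisGroup ℚ → ℤ_[2]) (ρA ρf : FramedGaloisRep ℚ ℤ_[2] 4) :
    Prop :=
  PairCertificate ν ρA ρf

/-- **The `N = 587`, sign `+` core certificate, as a hypothesis**: `CoreCertificate 587 checkPrimes587plus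
ν ρA ρf` — for framed `(ρ_{A⁺,2}, ρ_{f₅₈₇⁺,2})` attested OUTSIDE THE KERNEL by the merged plus
certificate (sha256 `9ac7f5381b505f82e7e8e9323eccada07156e3105b7cfaeb79e03dd40afb02f1`) read WITHOUT
its `trace_check` block (the hypothesis `h5` below): blocks `similitude` (cited), `residual` (Step 1 and
absolute irreducibility, as in `PairCertificate587plus`), and `classfield`/`group_theory`/`obstructing`
= the `A₅₈₇` Galois sub-certificate (sha256 `5ba9346a…`, cited there by hash) transferred along
`ℚ(A⁺[2]) = ℚ(A₅₈₇[2])` with an explicit isomorphism of Galois modules `A⁺[2] ≃ A₅₈₇[2]`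
(sub-certificate `certs/587/galois_plus`, sha256
`6872150ba85cff30fc63b069ff597ae964ff5b5b214e11a3b81869d39af57a0c`, ×2).  Equivalently
(`coreCertificate587plus_iff`) `GaloisCertificate587 ν ρA ∧ PairCertificate587plus ν ρA ρf`.
[cite: BrumerEtAl2019, Alg 2.4.1 p. 1156; §7.3 p. 1191] -/
def CoreCertificate587plus (ν : absoluteGaloisGroup ℚ → ℤ_[2]) (ρA ρf : FramedGaloisRep ℚ ℤ_[2] 4) :
    Prop :=
  CoreCertificate 587 checkPrimes587plus ν ρA ρf

variable {ν ν₀ : absoluteGaloisGroup ℚ → ℤ_[2]} {ρA ρf ρ₀ : FramedGaloisRep ℚ ℤ_[2] 4}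
  {A A₀ : AbelianVariety ℚ} {b : Module.Basis (Fin 4) ℚ_[2] (A.rationalTateModule 2)}
  {b₀ : Module.Basis (Fin 4) ℚ_[2] (A₀.rationalTateModule 2)} {f : Matrix (Fin 2) (Fin 2) ℂ → ℂ}

/-- The split of the plus core certificate into Galois half and pair datum (`coreCertificate_iff`).
[cite: BrumerEtAl2019, Alg 2.4.1 p. 1156] -/
theorem coreCertificate587plus_iff :
    CoreCertificate587plus ν ρA ρf ↔ GaloisCertificate587 ν ρA ∧ PairCertificate587plus ν ρA ρf :=
  coreCertificate_iff 587 checkPrimes587plus ν ρA ρf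

/-- A strict plus certificate (`Certificate587plus` of `Paramodular587plus.lean`, Gram matrix
`J = antiIdAlt4 ℤ_[2]`) contains the core certificate, so every discharge of the older schema serves
this one. [cite: BrumerEtAl2019, Alg 2.4.1 p. 1156] -/
theorem coreCertificate587plus_of_certificate587plus
    (hC : Certificate587plus (antiIdAlt4 ℤ_[2]) ν ρA ρf) : CoreCertificate587plus ν ρA ρf :=
  CoreCertificate.ofSurfaceConjCertificate (ConjCertificate.ofCertificate hC)

/-- **`A⁺` is paramodular of level `587` away from `587`, CORE form.**  `paramodular_of_coreCertificate`
with `N = 587`, `T = checkPrimes587plus` (`hT` = `checkPrimes587plus_good`).  Binders: `hC` the core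
certificate (hashes above); `hframe` [(4.1.3)]; Euler data `aA bA` / `af bf` in surface shape
`L_p = 1 − aT + bT² − paT³ + p²T⁴` with `hA` [(4.1.4)–(4.1.5)] and `hfe` [(4.2.18)]; `hρf_unr`
[Thm 4.3.4 (iii)], `hρf` [Thm 4.3.4 (iv)] (cited, Arthur-dependent); the Step-5 trace table
`h5 : ∀ p ∈ checkPrimes587plus, aA p = af p` (`0,0,−2,1,0,−2,5,9,−3,0,5` at `p = 3,…,41`, ×2 on both sides
in the certificate's `trace_check` block; closed by `decide` on those integers by any consumer); `hcusp`,
`hne` (`f ∈ S₂(K(587))⁺` a nonzero cusp form); `h2` the hand check at `p = 2` (`a₂ = −1`, `b₂ = 3` both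
sides). [cite: BrumerEtAl2019, Thm 2.1.5 p. 1150; Alg 2.4.1 p. 1156; Thm 4.3.4 p. 1169; §7.1 p. 1188; Thm 7.3.1 p. 1191 (the minus pair)] -/
theorem paramodular_587plus_of_coreCertificate (hC : CoreCertificate587plus ν ρA ρf)
    (hframe : A.IsFrameOfTateRep 2 b (rationalize ρA)) (aA bA af bf : ℕ → ℤ)
    (hA : ∀ p : ℕ, p.Prime → ¬ p ∣ 587 →
      A.HasGoodEulerFactorAt p ((lPolynomialOfSurface p (aA p) (bA p)).map (Int.castRingHom ℚ)))
    (hρf_unr : ∀ v ∉ placesOver (badPrimes 587), ρf.IsUnramifiedAt v)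
    (hρf : ∀ p : ℕ, p.Prime → ¬ p ∣ 587 → p ≠ 2 →
      ∀ v : HeightOneSpectrum (𝓞 ℚ), ((p : ℕ) : 𝓞 ℚ) ∈ v.asIdeal →
        ρf.HasFrobCharpolyAt v
          ((lPolynomialOfSurface p (af p) (bf p)).reverse.map (Int.castRingHom ℤ_[2])))
    (h5 : ∀ p ∈ checkPrimes587plus, aA p = af p)
    (hcusp : IsParamodularCuspForm 587 2 f) (hne : ∃ Z ∈ siegelUpperHalfSpace 2, f Z ≠ 0)
    (hfe : ∀ p : ℕ, p.Prime → ¬ p ∣ 587 →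
      HasSpinorEulerFactorAt 2 p f ((lPolynomialOfSurface p (af p) (bf p)).map (Int.castRingHom ℂ)))
    (h2 : aA 2 = af 2 ∧ bA 2 = bf 2) :
    IsParamodularAwayFrom A 587 f :=
  paramodular_of_coreCertificate hC hframe aA bA af bf hA hρf_unr hρf checkPrimes587plus_good h5 hcusp
    hne hfe (fun _ => h2)

/-- **`A⁺` is paramodular of level `587` away from `587`, by TRANSFER of the Galois half of `A₅₈₇`.**
`paramodular_of_galoisCertificate_S6` with `N = 587`, `T = checkPrimes587plus`, `q = 3`.  Binders about
BPPTVY's surface `A₀ = A₅₈₇` and its framed `ρ₀ = ρ_{A₅₈₇,2}`: `hG` its Galois half (sha256 `5ba9346a…`);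
`hcard : #im ρ̄₀ = 720` (the `2`-division field has Galois group `S₆`: same sub-certificate, block
`two_division.galois_group`, ×2); `hframe₀` [(4.1.3)]; `hA₃ : L₃(A₀,T) = 1 − a₃T + b₃T² − 3a₃T³ + 9T⁴` with
`h₃ : a₃` even, `b₃` odd (certified values `(a₃, b₃) = (−4, 9)`, i.e. `L₃ = 1 + 4T + 9T² + 12T³ + 9T⁴`,
`≡ 1 + T² + T⁴ (mod 2)` as printed in [§7.3]).  The link: `hker`, `ker ρ̄₀ = ker ρ̄_A`, i.e.
`ℚ(A₅₈₇[2]) = ℚ(A⁺[2])` (sub-certificate `certs/587/galois_plus`, sha256 `6872150b…`: both `2`-division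
sextics have `polredabs` = the printed sextic; stem-field isomorphisms in both directions, PARI and exact
arithmetic).  Binders about the plus pair: `hP` its pair datum (sha256 `9ac7f538…`), `hframe`, Euler data
`aA bA af bf` with `hA`, `hfe`, parities `h₃' : aA 3` even, `bA 3` odd (certified `(a₃, b₃)(A⁺) = (0, 1)`),
`hρf_unr`, `hρf` [Thm 4.3.4 (iii), (iv)], the trace table `h5`, `hcusp`, `hne`, `h2`.  Inside, the kernel
produces `π ∈ S₆` conjugating `ρ̄₀` to `ρ̄_A` [(5.1.8)] and moves Steps 2–4 of `A₅₈₇` to `A⁺`; no class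
field theory is attested for `A⁺`. [cite: BrumerEtAl2019, Thm 7.3.1 p. 1191; (5.1.8) p. 1174; Alg 2.4.1 p. 1156; Thm 2.1.5 p. 1150; Thm 4.3.4 p. 1169] -/
theorem paramodular_587plus_of_galoisCertificate (hG : GaloisCertificate587 ν₀ ρ₀)
    (hcard : Nat.card (residual ρ₀.toMonoidHom).range = 720)
    (hframe₀ : A₀.IsFrameOfTateRep 2 b₀ (rationalize ρ₀)) {a₃ b₃ : ℤ}
    (hA₃ : A₀.HasGoodEulerFactorAt 3 ((lPolynomialOfSurface 3 a₃ b₃).map (Int.castRingHom ℚ)))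
    (h₃ : Even a₃ ∧ Odd b₃)
    (hker : ∀ γ, residual ρ₀.toMonoidHom γ = 1 ↔ residual ρA.toMonoidHom γ = 1)
    (hP : PairCertificate587plus ν ρA ρf)
    (hframe : A.IsFrameOfTateRep 2 b (rationalize ρA)) (aA bA af bf : ℕ → ℤ)
    (hA : ∀ p : ℕ, p.Prime → ¬ p ∣ 587 →
      A.HasGoodEulerFactorAt p ((lPolynomialOfSurface p (aA p) (bA p)).map (Int.castRingHom ℚ)))
    (h₃' : Even (aA 3) ∧ Odd (bA 3))
    (hρf_unr : ∀ v ∉ placesOver (badPrimes 587), ρf.IsUnramifiedAt v)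
    (hρf : ∀ p : ℕ, p.Prime → ¬ p ∣ 587 → p ≠ 2 →
      ∀ v : HeightOneSpectrum (𝓞 ℚ), ((p : ℕ) : 𝓞 ℚ) ∈ v.asIdeal →
        ρf.HasFrobCharpolyAt v
          ((lPolynomialOfSurface p (af p) (bf p)).reverse.map (Int.castRingHom ℤ_[2])))
    (h5 : ∀ p ∈ checkPrimes587plus, aA p = af p)
    (hcusp : IsParamodularCuspForm 587 2 f) (hne : ∃ Z ∈ siegelUpperHalfSpace 2, f Z ≠ 0)
    (hfe : ∀ p : ℕ, p.Prime → ¬ p ∣ 587 →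
      HasSpinorEulerFactorAt 2 p f ((lPolynomialOfSurface p (af p) (bf p)).map (Int.castRingHom ℂ)))
    (h2 : aA 2 = af 2 ∧ bA 2 = bf 2) :
    IsParamodularAwayFrom A 587 f :=
  paramodular_of_galoisCertificate_S6 hG hcard hframe₀ hker hP hframe (by norm_num) (by norm_num) hA₃
    aA bA af bf hA (by norm_num) ⟨h₃.1, h₃.2, h₃'.1, h₃'.2⟩ hρf_unr hρf checkPrimes587plus_good h5 hcusp
    hne hfe (fun _ => h2)

/-- The conclusion at one prime `p ≠ 587`, transfer form: one polynomial is both `L_p(A⁺,T)` and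
`Q_p(f₅₈₇⁺,T)`. [cite: BrumerEtAl2019, Thm 7.3.1 p. 1191 (shape of the statement, minus pair)] -/
theorem eulerFactors_agree_587plus_of_galoisCertificate (hG : GaloisCertificate587 ν₀ ρ₀)
    (hcard : Nat.card (residual ρ₀.toMonoidHom).range = 720)
    (hframe₀ : A₀.IsFrameOfTateRep 2 b₀ (rationalize ρ₀)) {a₃ b₃ : ℤ}
    (hA₃ : A₀.HasGoodEulerFactorAt 3 ((lPolynomialOfSurface 3 a₃ b₃).map (Int.castRingHom ℚ)))
    (h₃ : Even a₃ ∧ Odd b₃)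
    (hker : ∀ γ, residual ρ₀.toMonoidHom γ = 1 ↔ residual ρA.toMonoidHom γ = 1)
    (hP : PairCertificate587plus ν ρA ρf)
    (hframe : A.IsFrameOfTateRep 2 b (rationalize ρA)) (aA bA af bf : ℕ → ℤ)
    (hA : ∀ p : ℕ, p.Prime → ¬ p ∣ 587 →
      A.HasGoodEulerFactorAt p ((lPolynomialOfSurface p (aA p) (bA p)).map (Int.castRingHom ℚ)))
    (h₃' : Even (aA 3) ∧ Odd (bA 3))
    (hρf_unr : ∀ v ∉ placesOver (badPrimes 587), ρf.IsUnramifiedAt v)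
    (hρf : ∀ p : ℕ, p.Prime → ¬ p ∣ 587 → p ≠ 2 →
      ∀ v : HeightOneSpectrum (𝓞 ℚ), ((p : ℕ) : 𝓞 ℚ) ∈ v.asIdeal →
        ρf.HasFrobCharpolyAt v
          ((lPolynomialOfSurface p (af p) (bf p)).reverse.map (Int.castRingHom ℤ_[2])))
    (h5 : ∀ p ∈ checkPrimes587plus, aA p = af p)
    (hcusp : IsParamodularCuspForm 587 2 f) (hne : ∃ Z ∈ siegelUpperHalfSpace 2, f Z ≠ 0)
    (hfe : ∀ p : ℕ, p.Prime → ¬ p ∣ 587 →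
      HasSpinorEulerFactorAt 2 p f ((lPolynomialOfSurface p (af p) (bf p)).map (Int.castRingHom ℂ)))
    (h2 : aA 2 = af 2 ∧ bA 2 = bf 2) {p : ℕ} (hp : p.Prime) (hpN : p ≠ 587) :
    ∃ Q : Polynomial ℚ, HasSpinorEulerFactorAt 2 p f (Q.map (algebraMap ℚ ℂ)) ∧
      A.HasGoodEulerFactorAt p Q :=
  eulerFactors_agree_587plus
    (paramodular_587plus_of_galoisCertificate hG hcard hframe₀ hA₃ h₃ hker hP hframe aA bA af bf hA h₃'
      hρf_unr hρf h5 hcusp hne hfe h2) hp hpN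

end Literature.NumberTheory.FaltingsSerre.Paramodular587plus

end
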